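import Mathlib
import HarnessLib
import Summits.QuantumFields.YangMills.Theorems.PencilRigidityShellRigidityAngularChart
import Summits.QuantumFields.YangMills.Theorems.PencilRigidityShellRigidityFourierVanish

/-!
# Angular rigidity below the planar threshold
(stub `stub_planarAngularRigidity`, crux `PencilRigidity.ShellRigidity`, line
`transverse-smearing-planar-threshold`, stmt-QuantumFields-11685)

Assembly of the sibling stubs `stub_angularChart` (complexified-angle charts of cone-supported
Laplace–Fourier measures) and `stub_fourierVanish` (Fourier modes of a `π/2`-periodic function with
charts of exponential type `σ < 8`). Statement: a planar kernel `F`, continuous off `0`, of order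
`0 < σ < 8`, `D₄`-symmetric, whose axis restrictions `F(ε + t, b)` and diagonal restrictions
`F((ε+u+v)/√2, (ε+u-v)/√2)` are, for every `ε > 0`, Laplace–Fourier transforms of finite measures
carried by the light cone, is constant on circles: `F(r cos φ, r sin φ) = F(r, 0)`.

Proof. `g(α) = F(r cos α, r sin α)` is continuous and `π/2`-periodic (`D₄`). At depth `Ψ` put
`ε = r cos(3π/8) e^{-Ψ}`; the axis chart `H_A` and the diagonal chart `H_D` (`stub_angularChart`)
take the real values `g(α)`, resp. `g(β - π/4)` (representations + `D₄`), so the identity theorem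
on the convex rectangle `V = {-3π/8 < Re w < π/8, |Im w| < Ψ}` glues `H_A(w) = H_D(w + π/4)`;
evenness of both charts gives the side relation `H_A(π/4 + iy) = H_A(-π/4 + iy)`, and the cone
bound gives `‖H_A(w)‖ ≤ |F(m_w, 0)| ≤ C' + C' (r cos(3π/8))^{-σ} e^{σ|Im w|}`. `stub_fourierVanish`
makes `g = c₀ + c₁ e^{4iα} + c₂ e^{-4iα}`; gluing this entire function to `H_A` on `V`, positivity
of both charts on the imaginary axis gives that `c₀ ± (c₁ e^{-4χ} + c₂ e^{4χ})` is real and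
nonnegative for all real `χ`, whence `‖c₁ e^{-4χ} + c₂ e^{4χ}‖ ≤ Re c₀`, so `c₁ = c₂ = 0`.
-/

noncomputable section

namespace Summit.QuantumFields.YangMills.Cruxes.ShellRigidity.TransverseSmearingPlanarThreshold

open MeasureTheory Complex Set Filter
open scoped InnerProductSpace Topology

/-! ## Helpers (sub-namespace `PlanarAngularRigidity`) -/

namespace PlanarAngularRigidity

/-- `0 < cos(3π/8)`. -/
theorem κ₀_pos : 0 < Real.cos (3 * Real.pi / 8) :=
  Real.cos_pos_of_mem_Ioo ⟨by linarith [Real.pi_pos], by linarith [Real.pi_pos]⟩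

/-- `cos(3π/8) ≤ cos x` for `|x| < 3π/8`. -/
theorem κ₀_le_cos {x : ℝ} (hx : |x| < 3 * Real.pi / 8) : Real.cos (3 * Real.pi / 8) ≤ Real.cos x := by
  rw [← Real.cos_abs x]
  exact Real.cos_le_cos_of_nonneg_of_le_pi (abs_nonneg x) (by linarith [Real.pi_pos]) hx.le

/-- The diagonal frame at angle `β` is the axis frame at angle `β - π/4`. -/
theorem diag_trig (r ε β : ℝ) :
    (ε + (r * Real.cos β - ε) + r * Real.sin β) / Real.sqrt 2 = r * Real.cos (β - Real.pi / 4) ∧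
    (ε + (r * Real.cos β - ε) - r * Real.sin β) / Real.sqrt 2 = -(r * Real.sin (β - Real.pi / 4)) ∧
    (ε + (r * Real.cos β - ε) + -(r * Real.sin β)) / Real.sqrt 2 =
      -(r * Real.sin (β - Real.pi / 4)) ∧
    (ε + (r * Real.cos β - ε) - -(r * Real.sin β)) / Real.sqrt 2 =
      r * Real.cos (β - Real.pi / 4) := by
  have h2 : (0 : ℝ) < Real.sqrt 2 := by positivity
  have hs : Real.sqrt 2 * Real.sqrt 2 = 2 := Real.mul_self_sqrt two_pos.le
  rw [Real.cos_sub, Real.sin_sub, Real.cos_pi_div_four, Real.sin_pi_div_four]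
  refine ⟨?_, ?_, ?_, ?_⟩ <;> rw [div_eq_iff h2.ne']
  · linear_combination (-(r * (Real.cos β + Real.sin β)) / 2) * hs
  · linear_combination (-(r * (Real.cos β - Real.sin β)) / 2) * hs
  · linear_combination (-(r * (Real.cos β - Real.sin β)) / 2) * hs
  · linear_combination (-(r * (Real.cos β + Real.sin β)) / 2) * hs

/-- Points `x + iy` of `V_Ψ`. -/
theorem mem_V {x y Ψ : ℝ} (hx1 : -(3 * Real.pi / 8) < x) (hx2 : x < Real.pi / 8) (hy : |y| < Ψ) :
    (x : ℂ) + y * I ∈ (Ioo (-(3 * Real.pi / 8)) (Real.pi / 8) ×ℂ Ioo (-(Ψ)) (Ψ)) := by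
  simp only [mem_reProdIm, add_re, ofReal_re, mul_re, I_re, mul_zero, ofReal_im, I_im, mul_one,
    sub_self, add_zero, add_im, mul_im, zero_add]
  exact ⟨⟨hx1, hx2⟩, abs_lt.1 hy⟩

/-- Identity theorem on `V_Ψ` from the real segment `(-3π/8, π/8)`. -/
theorem eqOn_V {Ψ : ℝ} (hΨ : 0 < Ψ) {f₁ f₂ : ℂ → ℂ} (hf₁ : DifferentiableOn ℂ f₁ ((Ioo (-(3 * Real.pi / 8)) (Real.pi / 8) ×ℂ Ioo (-(Ψ)) (Ψ))))
    (hf₂ : DifferentiableOn ℂ f₂ ((Ioo (-(3 * Real.pi / 8)) (Real.pi / 8) ×ℂ Ioo (-(Ψ)) (Ψ))))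
    (heq : ∀ x : ℝ, -(3 * Real.pi / 8) < x → x < Real.pi / 8 → f₁ x = f₂ x) :
    EqOn f₁ f₂ ((Ioo (-(3 * Real.pi / 8)) (Real.pi / 8) ×ℂ Ioo (-(Ψ)) (Ψ))) := by
  have hOo : IsOpen ((Ioo (-(3 * Real.pi / 8)) (Real.pi / 8) ×ℂ Ioo (-(Ψ)) (Ψ))) := isOpen_Ioo.reProdIm isOpen_Ioo
  have hOc : IsPreconnected ((Ioo (-(3 * Real.pi / 8)) (Real.pi / 8) ×ℂ Ioo (-(Ψ)) (Ψ))) := (convexHull_eq_self.1 (by rw [convexHull_reProdIm,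
    (convex_Ioo _ _).convexHull_eq, (convex_Ioo _ _).convexHull_eq])).isPreconnected
  have h0 : ((0 : ℝ) : ℂ) ∈ (Ioo (-(3 * Real.pi / 8)) (Real.pi / 8) ×ℂ Ioo (-(Ψ)) (Ψ)) := by
    rw [mem_reProdIm, ofReal_re, ofReal_im]
    exact ⟨⟨by linarith [Real.pi_pos], by positivity⟩, by linarith, hΨ⟩
  refine (hf₁.analyticOnNhd hOo).eqOn_of_preconnected_of_frequently_eq (hf₂.analyticOnNhd hOo)
    hOc h0 ?_
  have htend : Tendsto (fun t : ℝ => (t : ℂ)) (𝓝[≠] 0) (𝓝[≠] ((0 : ℝ) : ℂ)) := by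
    refine tendsto_nhdsWithin_of_tendsto_nhds_of_eventually_within _
      (continuous_ofReal.continuousAt.mono_left nhdsWithin_le_nhds) ?_
    filter_upwards [self_mem_nhdsWithin] with t ht
    simpa using ht
  have hev : ∀ᶠ t : ℝ in 𝓝[≠] 0, f₁ t = f₂ t := by
    have : Ioo (-(3 * Real.pi / 8)) (Real.pi / 8) ∈ 𝓝[≠] (0 : ℝ) :=
      mem_nhdsWithin_of_mem_nhds (Ioo_mem_nhds (by linarith [Real.pi_pos]) (by positivity))
    filter_upwards [this] with t ht using heq t ht.1 ht.2
  exact htend.frequently hev.frequently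

/-- The order bound at `(m, 0)` in the form `A + B e^{σ|ψ|}` when `m ≥ r c e^{-|ψ|}`. -/
theorem bound_step {F : ℝ × ℝ → ℝ} {C σ r c m ψ : ℝ} (hσ : 0 ≤ σ) (hrc : 0 < r * c)
    (hm : r * c * Real.exp (-|ψ|) ≤ m)
    (hC : ∀ x : ℝ × ℝ, x ≠ 0 → |F x| ≤ C * (1 + (x.1 ^ 2 + x.2 ^ 2) ^ (-(σ / 2)))) :
    |F (m, 0)| ≤ max C 0 + max C 0 * (r * c) ^ (-σ) * Real.exp (σ * |ψ|) := by
  have hm0 : 0 < m := lt_of_lt_of_le (by positivity) hm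
  have e1 : (m ^ 2 + (0 : ℝ) ^ 2) ^ (-(σ / 2)) = m ^ (-σ) := by
    rw [zero_pow two_ne_zero, add_zero, ← Real.rpow_natCast, ← Real.rpow_mul hm0.le]
    congr 1; push_cast; ring
  have e2 : m ^ (-σ) ≤ (r * c) ^ (-σ) * Real.exp (σ * |ψ|) := by
    calc m ^ (-σ) ≤ (r * c * Real.exp (-|ψ|)) ^ (-σ) :=
          Real.rpow_le_rpow_of_nonpos (by positivity) hm (by linarith)
      _ = (r * c) ^ (-σ) * Real.exp (σ * |ψ|) := by
          rw [Real.mul_rpow hrc.le (Real.exp_pos _).le, ← Real.exp_mul]; ring_nf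
  have hx : |F (m, 0)| ≤ C * (1 + m ^ (-σ)) := by
    have h := hC (m, 0) (by simp [Prod.ext_iff, hm0.ne'])
    rwa [e1] at h
  calc |F (m, 0)| ≤ C * (1 + m ^ (-σ)) := hx
    _ ≤ max C 0 * (1 + m ^ (-σ)) := by gcongr; exact le_max_left _ _
    _ ≤ max C 0 * (1 + (r * c) ^ (-σ) * Real.exp (σ * |ψ|)) := by gcongr
    _ = _ := by ring

/-- Exponential squeeze: `‖a e^{-4χ} + b e^{4χ}‖ ≤ M` for all real `χ` forces `b = 0`. -/
theorem coeff_zero {a b : ℂ} {M : ℝ}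
    (h : ∀ χ : ℝ, ‖a * cexp ((-(4 * χ) : ℝ) : ℂ) + b * cexp ((4 * χ : ℝ) : ℂ)‖ ≤ M) : b = 0 := by
  have key : ∀ χ : ℝ, 0 ≤ χ → ‖b‖ ≤ (M + ‖a‖) * Real.exp (-(4 * χ)) := by
    intro χ hχ
    have hE : Real.exp (4 * χ) * Real.exp (-(4 * χ)) = 1 := by
      rw [← Real.exp_add, add_neg_cancel, Real.exp_zero]
    have h1 : ‖b‖ * Real.exp (4 * χ) ≤ M + ‖a‖ * Real.exp (-(4 * χ)) := by
      have h2 := norm_sub_le (a * cexp ((-(4 * χ) : ℝ) : ℂ) + b * cexp ((4 * χ : ℝ) : ℂ))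
        (a * cexp ((-(4 * χ) : ℝ) : ℂ))
      rw [add_sub_cancel_left, norm_mul, norm_mul, norm_exp_ofReal, norm_exp_ofReal] at h2
      linarith [h χ]
    calc ‖b‖ = ‖b‖ * Real.exp (4 * χ) * Real.exp (-(4 * χ)) := by rw [mul_assoc, hE, mul_one]
      _ ≤ (M + ‖a‖ * Real.exp (-(4 * χ))) * Real.exp (-(4 * χ)) := by gcongr
      _ ≤ (M + ‖a‖) * Real.exp (-(4 * χ)) := by
          gcongr
          exact mul_le_of_le_one_right (norm_nonneg _) (Real.exp_le_one_iff.2 (by linarith))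
  have ht : Tendsto (fun χ : ℝ => (M + ‖a‖) * Real.exp (-(4 * χ))) atTop (𝓝 ((M + ‖a‖) * 0)) :=
    tendsto_const_nhds.mul (Real.tendsto_exp_comp_nhds_zero.2
      (tendsto_atBot.2 fun y => eventually_atTop.2 ⟨-y / 4, fun χ hχ => by linarith⟩))
  rw [mul_zero] at ht
  exact norm_le_zero_iff.1 (ge_of_tendsto ht (eventually_atTop.2 ⟨0, key⟩))

/-- `e^{±4iw}` at `w = iχ` and at `w = -π/4 + iχ`. -/
theorem cexp_points (χ : ℝ) :
    cexp (4 * ((χ : ℂ) * I) * I) = cexp ((-(4 * χ) : ℝ) : ℂ) ∧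
    cexp (-(4 * ((χ : ℂ) * I) * I)) = cexp ((4 * χ : ℝ) : ℂ) ∧
    cexp (4 * (((-(Real.pi / 4) : ℝ) : ℂ) + (χ : ℂ) * I) * I) = -cexp ((-(4 * χ) : ℝ) : ℂ) ∧
    cexp (-(4 * (((-(Real.pi / 4) : ℝ) : ℂ) + (χ : ℂ) * I) * I)) = -cexp ((4 * χ : ℝ) : ℂ) := by
  refine ⟨by congr 1; push_cast; linear_combination (4 * (χ : ℂ)) * I_sq,
    by congr 1; push_cast; linear_combination (-4 * (χ : ℂ)) * I_sq, ?_, ?_⟩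
  · rw [show 4 * (((-(Real.pi / 4) : ℝ) : ℂ) + (χ : ℂ) * I) * I = ((-(4 * χ) : ℝ) : ℂ) - Real.pi * I
      by push_cast; linear_combination (4 * (χ : ℂ)) * I_sq, Complex.exp_sub, exp_pi_mul_I]; ring
  · rw [show -(4 * (((-(Real.pi / 4) : ℝ) : ℂ) + (χ : ℂ) * I) * I) = ((4 * χ : ℝ) : ℂ) + Real.pi * I
      by push_cast; linear_combination (-4 * (χ : ℂ)) * I_sq, Complex.exp_add, exp_pi_mul_I]; ring

/-- The chart of `stub_angularChart` for a represented function `Φ`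
(`Φ t b = ∫ e^{-t p₀ + i b p₁} dμ` for `t ≥ 0`): holomorphy on the rectangle, the cone bound at time
`m_w - ε` with `m_w ≥ r cos(3π/8) e^{-|Im w|}`, real values, evenness, positivity on `iℝ`. -/
theorem chart (μ : Measure (EuclideanSpace ℝ (Fin 4))) [IsFiniteMeasure μ]
    (hE : μ {p | p 0 < 0} = 0) (hcone : μ {p | p 0 < |p 1|} = 0) {r ε Ψ : ℝ} (hr : 0 < r)
    (hε : 0 < ε) (hΨ : 0 < Ψ) (hεΨ : ε ≤ r * Real.cos (3 * Real.pi / 8) * Real.exp (-Ψ)) (Φ : ℝ → ℝ → ℂ)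
    (hΦ : ∀ t : ℝ, 0 ≤ t → ∀ b : ℝ,
      Φ t b = ∫ p, cexp ((((-(t * p 0) : ℝ)) : ℂ) + ((b * p 1 : ℝ) : ℂ) * I) ∂μ) :
    ∃ H : ℂ → ℂ, DifferentiableOn ℂ H {w : ℂ | |w.re| < 3 * Real.pi / 8 ∧ |w.im| < Ψ} ∧
      (∀ w : ℂ, |w.re| < 3 * Real.pi / 8 → |w.im| < Ψ →
        r * Real.cos (3 * Real.pi / 8) * Real.exp (-|w.im|) ≤ r * Real.cos w.re * Real.exp (-|w.im|) ∧
        ‖H w‖ ≤ ‖Φ (r * Real.cos w.re * Real.exp (-|w.im|) - ε) 0‖) ∧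
      (∀ α : ℝ, |α| < 3 * Real.pi / 8 → H α =
      (Φ (r * Real.cos α - ε) (r * Real.sin α) + Φ (r * Real.cos α - ε) (-(r * Real.sin α))) / 2) ∧
      (∀ w : ℂ, H (-w) = H w) ∧
      (∀ χ : ℝ, |χ| < Ψ → (H (χ * I)).im = 0 ∧ 0 ≤ (H (χ * I)).re) := by
  obtain ⟨h1, h2, h3, h4, h5⟩ := stub_angularChart μ hE hcone r ε Ψ hr hε hΨ hεΨ
    (fun w => ∫ p, cexp (-(((r : ℂ) * Complex.cos w - (ε : ℂ)) * ((p 0 : ℝ) : ℂ))) *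
      Complex.cos ((r : ℂ) * Complex.sin w * ((p 1 : ℝ) : ℂ)) ∂μ) (fun _ => rfl)
  have hκ₀ := κ₀_pos
  refine ⟨_, h1, fun w hre him => ?_, fun α hα => ?_, h4, h5⟩
  · have hm : r * Real.cos (3 * Real.pi / 8) * Real.exp (-|w.im|) ≤ r * Real.cos w.re * Real.exp (-|w.im|) := by
      gcongr; exact κ₀_le_cos hre
    have hΨ2 := mul_le_mul_of_nonneg_left (Real.exp_le_exp.2 (show -Ψ ≤ -|w.im| by linarith))
      (mul_pos hr hκ₀).le
    have ht : 0 ≤ r * Real.cos w.re * Real.exp (-|w.im|) - ε := by linarith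
    exact ⟨hm, by rw [hΦ _ ht 0]; exact h2 w hre him⟩
  · have hα' := mul_le_mul_of_nonneg_left (κ₀_le_cos hα) hr.le
    have hΨ1 := mul_le_of_le_one_right (mul_pos hr hκ₀).le
      (Real.exp_le_one_iff.2 (show -Ψ ≤ 0 by linarith))
    have ht : 0 ≤ r * Real.cos α - ε := by linarith
    rw [h3 α hα, hΦ _ ht, hΦ _ ht]

/-- The charts at depth `Ψ` for `g(α) = F(r cos α, r sin α)`: the axis chart `H` is holomorphic on
the rectangle, takes the real values `g`, satisfies the side relation `H(π/4 + iy) = H(-π/4 + iy)`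
and the bound `C' + C' (r cos(3π/8))^{-σ} e^{σ|Im w|}`, and is real nonnegative at `iχ` and (through
the glued diagonal chart) at `-π/4 + iχ`. -/
theorem key {F : ℝ × ℝ → ℝ} {σ C r : ℝ} (hσ : 0 ≤ σ) (hr : 0 < r)
    (hC : ∀ x : ℝ × ℝ, x ≠ 0 → |F x| ≤ C * (1 + (x.1 ^ 2 + x.2 ^ 2) ^ (-(σ / 2))))
    (hsym : ∀ t s : ℝ, F (t, s) = F (s, t) ∧ F (t, s) = F (t, -s) ∧ F (t, s) = F (-t, s))
    (hA : ∀ ε : ℝ, 0 < ε → ∃ μ : Measure (EuclideanSpace ℝ (Fin 4)), IsFiniteMeasure μ ∧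
      μ {p | p 0 < 0} = 0 ∧ μ {p | p 0 < |p 1|} = 0 ∧
      ∀ t : ℝ, 0 ≤ t → ∀ b : ℝ, ((F (ε + t, b) : ℝ) : ℂ) =
        ∫ p, cexp ((((-(t * p 0) : ℝ)) : ℂ) + ((b * p 1 : ℝ) : ℂ) * I) ∂μ)
    (hD : ∀ ε : ℝ, 0 < ε → ∃ μ : Measure (EuclideanSpace ℝ (Fin 4)), IsFiniteMeasure μ ∧
      μ {p | p 0 < 0} = 0 ∧ μ {p | p 0 < |p 1|} = 0 ∧
      ∀ u : ℝ, 0 ≤ u → ∀ v : ℝ, ((F ((ε + u + v) / Real.sqrt 2, (ε + u - v) / Real.sqrt 2) : ℝ) : ℂ) =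
        ∫ p, cexp ((((-(u * p 0) : ℝ)) : ℂ) + ((v * p 1 : ℝ) : ℂ) * I) ∂μ)
    (Ψ : ℝ) (hΨ : 0 < Ψ) :
    ∃ H : ℂ → ℂ, DifferentiableOn ℂ H {w : ℂ | |w.re| < 3 * Real.pi / 8 ∧ |w.im| < Ψ} ∧
      (∀ α : ℝ, |α| < 3 * Real.pi / 8 → H α = ((F (r * Real.cos α, r * Real.sin α) : ℝ) : ℂ)) ∧
      (∀ y : ℝ, |y| < Ψ →
        H (((Real.pi / 4 : ℝ) : ℂ) + y * I) = H (((-(Real.pi / 4) : ℝ) : ℂ) + y * I)) ∧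
      (∀ w : ℂ, |w.re| < 3 * Real.pi / 8 → |w.im| < Ψ →
        ‖H w‖ ≤ max C 0 + max C 0 * (r * Real.cos (3 * Real.pi / 8)) ^ (-σ) * Real.exp (σ * |w.im|)) ∧
      (∀ χ : ℝ, |χ| < Ψ → ((H (χ * I)).im = 0 ∧ 0 ≤ (H (χ * I)).re) ∧
        (H (((-(Real.pi / 4) : ℝ) : ℂ) + χ * I)).im = 0 ∧
        0 ≤ (H (((-(Real.pi / 4) : ℝ) : ℂ) + χ * I)).re) := by
  have hκ₀ := κ₀_pos
  set ε := r * Real.cos (3 * Real.pi / 8) * Real.exp (-Ψ)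
  have hε : 0 < ε := by positivity
  obtain ⟨μA, hfA, hEA, hcA, hrepA⟩ := hA ε hε
  obtain ⟨μD, hfD, hED, hcD, hrepD⟩ := hD ε hε
  obtain ⟨HA, hA1, hA2, hA3, hA4, hA5⟩ := chart μA hEA hcA hr hε hΨ le_rfl
    (fun t b => ((F (ε + t, b) : ℝ) : ℂ)) hrepA
  obtain ⟨HD, hD1, -, hD3, hD4, hD5⟩ := chart μD hED hcD hr hε hΨ le_rfl
    (fun u v => ((F ((ε + u + v) / Real.sqrt 2, (ε + u - v) / Real.sqrt 2) : ℝ) : ℂ)) hrepD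
  -- real values of the two charts
  have hgA : ∀ α : ℝ, |α| < 3 * Real.pi / 8 →
      HA α = ((F (r * Real.cos α, r * Real.sin α) : ℝ) : ℂ) := by
    intro α hα
    rw [hA3 α hα, show ε + (r * Real.cos α - ε) = r * Real.cos α by ring, ← (hsym _ _).2.1]
    ring
  have hgD : ∀ β : ℝ, |β| < 3 * Real.pi / 8 →
      HD β = ((F (r * Real.cos (β - Real.pi / 4), r * Real.sin (β - Real.pi / 4)) : ℝ) : ℂ) := by
    intro β hβ
    obtain ⟨e1, e2, e3, e4⟩ := diag_trig r ε β
    rw [hD3 β hβ, e1, e2, e3, e4, ← (hsym _ _).2.1, ← (hsym _ _).2.2, (hsym (r * Real.sin _) _).1]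
    ring
  -- gluing the diagonal chart to the axis chart on `V_Ψ`
  have hV : EqOn HA (fun w => HD (w + ((Real.pi / 4 : ℝ) : ℂ))) ((Ioo (-(3 * Real.pi / 8)) (Real.pi / 8) ×ℂ Ioo (-(Ψ)) (Ψ))) := by
    refine eqOn_V hΨ (hA1.mono fun w (hw : w ∈ (Ioo (-(3 * Real.pi / 8)) (Real.pi / 8) ×ℂ Ioo (-(Ψ)) (Ψ))) => ⟨abs_lt.2 ⟨hw.1.1, ?_⟩, abs_lt.2 hw.2⟩)
      (hD1.comp ((differentiable_id.add_const ((Real.pi / 4 : ℝ) : ℂ)).differentiableOn)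
        fun w (hw : w ∈ (Ioo (-(3 * Real.pi / 8)) (Real.pi / 8) ×ℂ Ioo (-(Ψ)) (Ψ))) => ?_) fun x hx1 hx2 => ?_
    · linarith [hw.1.2, Real.pi_pos]
    · simp only [mem_setOf_eq, add_re, ofReal_re, add_im, ofReal_im, add_zero]
      exact ⟨abs_lt.2 ⟨by linarith [hw.1.1, Real.pi_pos], by linarith [hw.1.2]⟩, abs_lt.2 hw.2⟩
    · show HA x = HD (↑x + ↑(Real.pi / 4))
      rw [← ofReal_add, hgD _ (abs_lt.2 ⟨by linarith [Real.pi_pos], by linarith⟩),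
        add_sub_cancel_right,
        hgA _ (abs_lt.2 ⟨by linarith [Real.pi_pos], by linarith [Real.pi_pos]⟩)]
  have hV' : ∀ y : ℝ, |y| < Ψ → HA (((-(Real.pi / 4) : ℝ) : ℂ) + y * I) = HD (y * I) := by
    intro y hy
    rw [hV (mem_V (by linarith [Real.pi_pos]) (by linarith [Real.pi_pos]) hy)]
    show HD (((-(Real.pi / 4) : ℝ) : ℂ) + y * I + ((Real.pi / 4 : ℝ) : ℂ)) = HD (y * I)
    congr 1; push_cast; ring
  refine ⟨HA, hA1, hgA, fun y hy => ?_, fun w hre him => ?_, fun χ hχ => ⟨hA5 χ hχ, ?_⟩⟩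
  · -- the side relation, from evenness of both charts
    rw [hV' y hy, show ((Real.pi / 4 : ℝ) : ℂ) + y * I =
        -(((-(Real.pi / 4) : ℝ) : ℂ) + ((-y : ℝ) : ℂ) * I) by push_cast; ring,
      hA4, hV' (-y) (by rwa [abs_neg]), show ((-y : ℝ) : ℂ) * I = -(y * I) by push_cast; ring, hD4]
  · -- the bound, from the cone bound and the order of `F`
    obtain ⟨hm, hle⟩ := hA2 w hre him
    refine hle.trans ?_
    show ‖((F (ε + (r * Real.cos w.re * Real.exp (-|w.im|) - ε), 0) : ℝ) : ℂ)‖ ≤ _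
    rw [show ε + (r * Real.cos w.re * Real.exp (-|w.im|) - ε) =
      r * Real.cos w.re * Real.exp (-|w.im|) by ring, norm_real, Real.norm_eq_abs]
    exact bound_step hσ (mul_pos hr hκ₀) hm hC
  · rw [hV' χ hχ]; exact hD5 χ hχ

end PlanarAngularRigidity

open PlanarAngularRigidity in
/-- **Angular rigidity below the planar threshold** (the lead's stub 7; assembly of
`stub_angularChart` and `stub_fourierVanish`). `F` continuous off `0`, of order `0 < σ < 8`,
`D₄`-symmetric, whose shifted restrictions `F(ε + t, b)` (axis chart) and
`F((ε+u+v)/√2, (ε+u-v)/√2)` (diagonal chart) are, for every `ε > 0`, Laplace–Fourier transforms of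
finite measures carried by the light cone, is constant on circles: `F(r cos φ, r sin φ) = F(r, 0)`.
Sharp at `σ = 8` (`Theorems/ShellRigidity/Negative/PlanarThresholdSharp.lean`). -/
theorem stub_planarAngularRigidity (F : ℝ × ℝ → ℝ) (σ : ℝ) (hσ : 0 < σ) (hσ8 : σ < 8)
    (hc : ContinuousOn F {x | x ≠ 0})
    (hb : ∃ C : ℝ, ∀ x : ℝ × ℝ, x ≠ 0 → |F x| ≤ C * (1 + (x.1 ^ 2 + x.2 ^ 2) ^ (-(σ / 2))))
    (hsym : ∀ t s : ℝ, F (t, s) = F (s, t) ∧ F (t, s) = F (t, -s) ∧ F (t, s) = F (-t, s))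
    (hA : ∀ ε : ℝ, 0 < ε → ∃ μ : Measure (EuclideanSpace ℝ (Fin 4)), IsFiniteMeasure μ ∧
      μ {p | p 0 < 0} = 0 ∧ μ {p | p 0 < |p 1|} = 0 ∧
      ∀ t : ℝ, 0 ≤ t → ∀ b : ℝ, ((F (ε + t, b) : ℝ) : ℂ) =
        ∫ p, cexp ((((-(t * p 0) : ℝ)) : ℂ) + ((b * p 1 : ℝ) : ℂ) * I) ∂μ)
    (hD : ∀ ε : ℝ, 0 < ε → ∃ μ : Measure (EuclideanSpace ℝ (Fin 4)), IsFiniteMeasure μ ∧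
      μ {p | p 0 < 0} = 0 ∧ μ {p | p 0 < |p 1|} = 0 ∧
      ∀ u : ℝ, 0 ≤ u → ∀ v : ℝ, ((F ((ε + u + v) / Real.sqrt 2, (ε + u - v) / Real.sqrt 2) : ℝ) : ℂ) =
        ∫ p, cexp ((((-(u * p 0) : ℝ)) : ℂ) + ((v * p 1 : ℝ) : ℂ) * I) ∂μ) :
    ∀ r φ : ℝ, 0 < r → F (r * Real.cos φ, r * Real.sin φ) = F (r, 0) := by
  intro r φ hr
  obtain ⟨C, hC⟩ := hb
  -- `g(α) = F(r cos α, r sin α)` is continuous and `π/2`-periodic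
  have hg_cont : Continuous fun α : ℝ => ((F (r * Real.cos α, r * Real.sin α) : ℝ) : ℂ) := by
    refine continuous_ofReal.comp (hc.comp_continuous
      (f := fun α : ℝ => (r * Real.cos α, r * Real.sin α)) (by fun_prop) fun α => ?_)
    simp only [mem_setOf_eq, ne_eq, Prod.ext_iff, Prod.fst_zero, Prod.snd_zero, mul_eq_zero,
      hr.ne', false_or, not_and]
    intro h1 h2
    nlinarith [Real.sin_sq_add_cos_sq α]
  have hg_per : Function.Periodic (fun α : ℝ => ((F (r * Real.cos α, r * Real.sin α) : ℝ) : ℂ))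
      (Real.pi / 2) := by
    intro α
    simp only [Real.cos_add_pi_div_two, Real.sin_add_pi_div_two, mul_neg]
    rw [← (hsym _ _).2.2, (hsym (r * Real.sin α) _).1]
  -- `g` is a trigonometric polynomial of degree `≤ 1` in `e^{4iα}`
  obtain ⟨a₀, a₁, a₂, hP⟩ := stub_fourierVanish _ hg_cont hg_per σ _ _ hσ8 fun Ψ hΨ =>
    (key hσ.le hr hC hsym hA hD Ψ hΨ).imp fun H h => ⟨h.1, h.2.1, h.2.2.1, h.2.2.2.1⟩
  -- positivity in both charts: `‖a₁ e^{-4χ} + a₂ e^{4χ}‖ ≤ Re a₀`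
  have hu : ∀ χ : ℝ, ‖a₁ * cexp ((-(4 * χ) : ℝ) : ℂ) + a₂ * cexp ((4 * χ : ℝ) : ℂ)‖ ≤ a₀.re := by
    intro χ
    obtain ⟨H, h1, h2, -, -, h5⟩ := key hσ.le hr hC hsym hA hD (|χ| + 1) (by positivity)
    have hχ : |χ| < |χ| + 1 := lt_add_one _
    have hEq := eqOn_V (f₁ := H)
      (f₂ := fun w : ℂ => a₀ + a₁ * cexp (4 * w * I) + a₂ * cexp (-(4 * w * I)))
      (by positivity : (0 : ℝ) < |χ| + 1) (h1.mono fun w (hw : w ∈ (Ioo (-(3 * Real.pi / 8)) (Real.pi / 8) ×ℂ Ioo (-((|χ| + 1))) ((|χ| + 1)))) =>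
        ⟨abs_lt.2 ⟨hw.1.1, by linarith [hw.1.2, Real.pi_pos]⟩, abs_lt.2 hw.2⟩)
      (by fun_prop : Differentiable ℂ fun w : ℂ =>
        a₀ + a₁ * cexp (4 * w * I) + a₂ * cexp (-(4 * w * I))).differentiableOn
      fun x hx1 hx2 => by
        rw [h2 x (abs_lt.2 ⟨by linarith [Real.pi_pos], by linarith [Real.pi_pos]⟩), hP x]
    obtain ⟨i1, i2, i3, i4⟩ := cexp_points χ
    have e1 : H (χ * I) = a₀ + (a₁ * cexp ((-(4 * χ) : ℝ) : ℂ) + a₂ * cexp ((4 * χ : ℝ) : ℂ)) := by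
      have h := hEq (mem_V (x := 0) (by linarith [Real.pi_pos]) (by positivity) hχ)
      rw [ofReal_zero, zero_add] at h
      rw [h]
      show a₀ + a₁ * cexp (4 * ((χ : ℂ) * I) * I) + a₂ * cexp (-(4 * ((χ : ℂ) * I) * I)) = _
      rw [i1, i2, add_assoc]
    have e2 : H (((-(Real.pi / 4) : ℝ) : ℂ) + χ * I) =
        a₀ - (a₁ * cexp ((-(4 * χ) : ℝ) : ℂ) + a₂ * cexp ((4 * χ : ℝ) : ℂ)) := by
      rw [hEq (mem_V (by linarith [Real.pi_pos]) (by linarith [Real.pi_pos]) hχ)]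
      show a₀ + a₁ * cexp (4 * (((-(Real.pi / 4) : ℝ) : ℂ) + (χ : ℂ) * I) * I) +
        a₂ * cexp (-(4 * (((-(Real.pi / 4) : ℝ) : ℂ) + (χ : ℂ) * I) * I)) = _
      rw [i3, i4]; ring
    obtain ⟨⟨h5a, h5b⟩, h5c, h5d⟩ := h5 χ hχ
    rw [e1] at h5a h5b
    rw [e2] at h5c h5d
    rw [add_im] at h5a; rw [add_re] at h5b; rw [sub_im] at h5c; rw [sub_re] at h5d
    have hz : (a₁ * cexp ((-(4 * χ) : ℝ) : ℂ) + a₂ * cexp ((4 * χ : ℝ) : ℂ)).im = 0 := by linarith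
    refine (norm_le_abs_re_add_abs_im _).trans ?_
    rw [hz, abs_zero, add_zero]
    exact abs_le.2 ⟨by linarith, by linarith⟩
  -- hence `a₁ = a₂ = 0` and `g` is constant
  have ha₂ : a₂ = 0 := coeff_zero hu
  have ha₁ : a₁ = 0 := coeff_zero (a := a₂) (M := a₀.re) fun χ => by
    have h := hu (-χ)
    rwa [show (-(4 * -χ) : ℝ) = 4 * χ by ring, show (4 * -χ : ℝ) = -(4 * χ) by ring, add_comm] at h
  have h1 := hP φ
  have h0 := hP 0
  rw [ha₁, ha₂] at h1 h0
  simp only [zero_mul, add_zero, Real.cos_zero, Real.sin_zero, mul_one, mul_zero] at h1 h0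
  exact_mod_cast h1.trans h0.symm

end Summit.QuantumFields.YangMills.Cruxes.ShellRigidity.TransverseSmearingPlanarThreshold
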